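import Summits.Ventures.HSemireg.WedgeHankelRecurrenceCompanion

/-!
# Venture HSemireg — THE SHIFT MATRIX GENERATES THE RESIDUE ALGEBRA: the multiplication matrices `M_a = mulResidueMat m a` (N73) of `K[X]/(m)` in the monomial basis are MULTIPLICATIVE
# (`M_{ab} = M_a M_b`, `M_1 = 1`, `M_{X^j} = M_X^j`); the shift ∕ companion matrix `M_X` (N82: `charpoly M_X = m`) **satisfies its own connection polynomial, `m(M_X) = 0` (Cayley–Hamilton),
# and is invertible iff the feedback is non-singular, `m(0) ≠ 0`**

HONEST FRAMING. Part of the Lean index of the computation cell `pub-hsemireg` (seat p10 gen 30, Sunday typer «UNIFORM-IN-n»).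
LINEAR ALGEBRA OF HANKEL (catalecticant) MATRICES and of polynomials over a field ONLY (`Algebra.leftMulMatrix`, `Matrix.charpoly`): no variety, no cohomology theory, no sheaf, no Ext group
and no semiregularity map is constructed here; nothing here says that HC / HC_CM / HC_AV holds; no Literature fact is declared or used.  Custodian versions as in `WedgeHankelSiegelIdeal` (1/3).

WHAT IS IN THE TREE.  N73 (`WedgeHankelRecurrenceHankelDeterminant`): `mulResidueMat`, `reindex_leftMulMatrix_eq_mulResidueMat` (`M_a` is the reindexed `Algebra.leftMulMatrix` of `a mod m` in
`AdjoinRoot.powerBasisAux'`).  N82 (`WedgeHankelRecurrenceCompanion`): `charpoly_mulResidueMat_X`, `det_mulResidueMat_X` (`det M_X = (−1)^{t+1} m(0)`).  Mathlib: `map_mul`/`map_one` of the algebra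
hom `Algebra.leftMulMatrix`, `Matrix.submatrix_mul_equiv`, `Matrix.submatrix_one_equiv`, `Matrix.aeval_self_charpoly`, `Matrix.isUnit_iff_isUnit_det`.
THIS FILE (namespace `Summit.Ventures.HSemireg.Wedge.HankelOuter` continued; PLAIN on N82 (hence N73); 0 definitions; `m` monic of degree `t + 1` throughout):
* §648 `mulResidueMat_one` (`M_1 = 1`), **`mulResidueMat_mul`** (`M_{ab} = M_a · M_b`), `mulResidueMat_X_pow` (`M_{X^j} = M_X^j`), **`aeval_mulResidueMat_X_self`** (`m(M_X) = 0`),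
  **`isUnit_mulResidueMat_X_iff`** (`M_X` invertible ↔ `m(0) ≠ 0` — non-singular feedback).
Nothing Ext-side.  New names only.
-/

open Module Polynomial
open scoped Matrix Polynomial

namespace Summit.Ventures.HSemireg.Wedge.HankelOuter

open Summit.Ventures.HSemireg.Wedge Summit.Ventures.HSemireg.Wedge.Hankel

variable (K : Type*) [Field K]

/-! ## §648. The shift matrix generates the residue algebra -/

/-- `M_1 = 1`: multiplication by `1` on `K[X]/(m)` is the identity matrix (`m` monic of degree `t + 1`). -/
theorem mulResidueMat_one {t : ℕ} {m : K[X]} (hm : m.Monic) (hmd : m.natDegree = t + 1) : mulResidueMat K t m 1 = 1 := by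
  rw [← reindex_leftMulMatrix_eq_mulResidueMat K hm hmd, map_one, map_one, Matrix.reindex_apply, Matrix.submatrix_one_equiv]

/-- **`M_{ab} = M_a · M_b`**: the multiplication matrices of the residue algebra `K[X]/(m)` are multiplicative (`m` monic of degree `t + 1`; the regular representation is an algebra hom). -/
theorem mulResidueMat_mul {t : ℕ} {m : K[X]} (hm : m.Monic) (hmd : m.natDegree = t + 1) (a b : K[X]) :
    mulResidueMat K t m (a * b) = mulResidueMat K t m a * mulResidueMat K t m b := by
  rw [← reindex_leftMulMatrix_eq_mulResidueMat K hm hmd, ← reindex_leftMulMatrix_eq_mulResidueMat K hm hmd a, ← reindex_leftMulMatrix_eq_mulResidueMat K hm hmd b, map_mul, map_mul,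
    Matrix.reindex_apply, Matrix.reindex_apply, Matrix.reindex_apply, Matrix.submatrix_mul_equiv]

/-- `M_{X^j} = M_X^j`: the multiplication matrix of `X^j` is the `j`-th power of the shift matrix. -/
theorem mulResidueMat_X_pow {t : ℕ} {m : K[X]} (hm : m.Monic) (hmd : m.natDegree = t + 1) (j : ℕ) :
    mulResidueMat K t m (Polynomial.X ^ j) = mulResidueMat K t m Polynomial.X ^ j := by
  induction j with
  | zero => rw [pow_zero, pow_zero, mulResidueMat_one K hm hmd]
  | succ j ih => rw [pow_succ, pow_succ, mulResidueMat_mul K hm hmd, ih]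

/-- **CAYLEY–HAMILTON FOR THE SHIFT MATRIX: `m(M_X) = 0`** — the companion ∕ shift matrix of a class satisfies its connection polynomial (N82: `charpoly M_X = m`). -/
theorem aeval_mulResidueMat_X_self {t : ℕ} {m : K[X]} (hm : m.Monic) (hmd : m.natDegree = t + 1) : aeval (mulResidueMat K t m Polynomial.X) m = 0 := by
  have h := Matrix.aeval_self_charpoly (mulResidueMat K t m Polynomial.X)
  rwa [charpoly_mulResidueMat_X K hm hmd] at h

/-- **THE SHIFT MATRIX IS INVERTIBLE IFF THE FEEDBACK IS NON-SINGULAR: `IsUnit M_X ↔ m(0) ≠ 0`** (`det M_X = (−1)^{t+1} m(0)`, N82). -/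
theorem isUnit_mulResidueMat_X_iff {t : ℕ} {m : K[X]} (hm : m.Monic) (hmd : m.natDegree = t + 1) : IsUnit (mulResidueMat K t m Polynomial.X) ↔ m.coeff 0 ≠ 0 := by
  rw [Matrix.isUnit_iff_isUnit_det, det_mulResidueMat_X K hm hmd, isUnit_iff_ne_zero, mul_ne_zero_iff]
  exact ⟨fun h => h.2, fun h => ⟨pow_ne_zero _ (neg_ne_zero.mpr one_ne_zero), h⟩⟩

end Summit.Ventures.HSemireg.Wedge.HankelOuter
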